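import Summits.ValiantsHypothesis.ValiantsHypothesis.Theorems.LacunarySymmetroidMatrixDescartesCensusDoorA34SheetTwistedBlocks
import Summits.ValiantsHypothesis.ValiantsHypothesis.Theorems.LacunarySymmetroidMatrixDescartesCensusDoorA34IsotropicTangentCentre
import Summits.ValiantsHypothesis.ValiantsHypothesis.Theorems.LacunarySymmetroidMatrixDescartesCensusDoorA34SheetWindowGramPrinciple
import Summits.ValiantsHypothesis.ValiantsHypothesis.Theorems.LacunarySymmetroidMatrixDescartesCensusBlockCone

/-!
# `MatrixDescartes` census — DOOR A at `(3,4)`: the FOUR TWISTED LETTER WINDOWS OF A NINETEEN ARE GRAM-ORIENTED —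
# a magnitude-level certificate for the crux format itself (`≤ 18` on the anti-oriented region of each letter window), any real letters

HONEST FRAMING.  Object-search cell `pub-symmetroid`, engine seat `val-sym-eng-2` (g12); helper rows `--supports` the OPEN typed statement
`Theses.LacunarySymmetroid.DoorA34 = PosRootLawAt 3 4 18` (stmt-ValiantsHypothesis-19980), asserted nowhere.  Companion of …SheetTwistedMiddleGram (the null-top
sheet, p725357): the same chain «Rolle twists ⇒ Descartes-sharp sub-word ⇒ Gram orientation principle» applied to the DOOR (full support, `19` roots, no stratum
hypothesis), using g8's `Census.twistedSubword_sharp_of_nineteen` and g11's `Census.orientation_eq_sign_gramDet` / `…_mirror`.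

THE LETTER WINDOWS.  For a letter `k` and the other three letters `p, q, r` (with `d_q = d_p + a`, `d_r = d_p + b`, `0 < a < b`, `2a ≠ b`) the six slots
containing `k` EXACTLY ONCE, `{k,p,p}, {k,p,q}, {k,q,q}, {k,p,r}, {k,q,r}, {k,r,r}`, have exponents `d_k + 2d_p + (0, a, 2a, b, a+b, 2b)`: a SIX-NOMIAL WINDOW in the
shape of a three-letter `2 × 2` determinant.  `k = 3` is the middle window of the strata line (`(p,q,r) = (0,1,2)`, core gaps); `k = 0` its mirror at the bottom letter
(`(1,2,3)`); `k = 1, 2` are the two «long» windows through `d₃` (`(0,2,3)`, `(0,1,3)`), window-shaped as soon as `d₃ − d₀ > 2(d₂ − d₀)`.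

Results (any real `3 × 3` letters, any `d`; `W(n) = ∏ (n − σ(u))` over the exponents of the fourteen slots OUTSIDE the window, `c̃ᵢ = W·coeff` on the window):

* **`twistedLetterWindow_five_roots_of_nineteen`** — `19` distinct positive roots ⇒ the twisted letter window `c̃₀ + c̃₁x^a + c̃₂x^{2a} + c̃₃x^b + c̃₄x^{a+b} + c̃₅x^{2b}`
  has at least five distinct positive roots (every letter `k`, every chamber);
* **`twistedLetterWindow_gram_orientation_of_nineteen`** (`2a < b`) / **`…_mirror`** (`b < 2a`) — hence its Gram determinant
  `Δ̃ = c̃₀c̃₂c̃₅ + c̃₁c̃₃c̃₄/4 − c̃₀c̃₄²/4 − c̃₂c̃₃²/4 − c̃₅c̃₁²/4` is ORIENTED: `0 < c̃₅Δ̃ ∧ c̃₀Δ̃ < 0 ∧ c̃₂Δ̃ < 0`, resp. `0 < c̃₀Δ̃ ∧ c̃₅Δ̃ < 0 ∧ c̃₂Δ̃ < 0`;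
* **`posRoots_le_18_of_twistedLetterWindow_antiOriented`** / **`…_mirror`** — THE CERTIFICATE FOR THE CRUX FORMAT: with the LETTER data
  `c̃ = W·(tr(adj S_p·S_k), tr(B(S_p,S_q)·S_k), tr(adj S_q·S_k), tr(B(S_p,S_r)·S_k), tr(B(S_q,S_r)·S_k), tr(adj S_r·S_k))`, `B(X,Y) = adj(X+Y) − adj X − adj Y`
  (`Census.coeff_det_pencil_three_square/_mixed` with `square/mixed_unique_of_nineteen`), every real `(3,4)` pencil whose twisted `k`-window is NOT Gram-oriented
  (`c̃₅Δ̃ ≤ 0` on window shapes, `c̃₀Δ̃ ≤ 0` on mirror shapes) has at most `18` distinct positive roots — `PosRootLawAt 3 4 18` holds on the union of these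
  four (eight, with mirrors) closed semialgebraic regions, for ALL real letters (the general real column reaches `19`, `Census.G3K4E1`, so these regions are
  proper; they are magnitude-level, beyond the sign atlas and beside the kernel Newton cone `Census.newton_cone_coeff`).

Nothing here bounds `ζ_sym(3,4)`; `DoorA34`, the strata stubs and `MatrixDescartes` (stmt-ValiantsHypothesis-18050) stay OPEN; registers unchanged
(`ζ_sym(3,4) ∈ {18,19}`); nothing on `VP ≠ VNP` — VP≠VNP not moved.  [folklore] Rolle twists + Descartes sharpness + the Gram orientation principle; no single source.
-/

-- `Summit.ValiantsHypothesis.ValiantsHypothesis.…` repeats a component by the D-0017 layout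
-- (single-conjunct summit), which the `dupNamespace` linter flags; the name is mandated.
set_option linter.dupNamespace false

namespace Summit.ValiantsHypothesis.ValiantsHypothesis.Theorems.LacunarySymmetroidMatrixDescartes.Census

open Polynomial Finset
open scoped BigOperators Polynomial Matrix

/-! ## 1. Five roots of a twisted letter window of a nineteen -/

/-- **FIVE ROOTS OF A TWISTED LETTER WINDOW OF A NINETEEN.**  Any real `3 × 3` letters, any `d`; letters `k, p, q, r` with `d_q = d_p + a`,
`d_r = d_p + b`, `0 < a < b`, `2a ≠ b` (so the six window exponents are distinct); `19` distinct positive roots.  With `W(n) = ∏ (n − σ(u))` over the exponents of the fourteen slots outside the `k`-window and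
`c̃ᵢ = W(e)·coeff(e)` at `e = 2d_p + d_k, d_p+d_q+d_k, 2d_q+d_k, d_p+d_r+d_k, d_q+d_r+d_k, 2d_r+d_k`, the six-nomial `c̃₀ + c̃₁x^a + c̃₂x^{2a} + c̃₃x^b + c̃₄x^{a+b} + c̃₅x^{2b}` has
at least five distinct positive roots. [folklore] -/
theorem twistedLetterWindow_five_roots_of_nineteen (d : Fin 4 → ℕ) (S : Fin 4 → Matrix (Fin 3) (Fin 3) ℝ)
    (h19 : 19 ≤ ((Matrix.det (∑ l, ((X : ℝ[X]) ^ d l) • (S l).map C)).roots.toFinset.filter (fun t => 0 < t)).card)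
    (k p q r : Fin 4)
    {a b : ℕ} (ha : d q = d p + a) (hb : d r = d p + b) (ha0 : 0 < a) (hab : a < b) (h2ab : 2 * a ≠ b)
    (W : ℕ → ℝ) (hW : ∀ n, W n =
      ∏ E ∈ (((Finset.univ : Finset (Sym (Fin 4) 3)) \
          ({⟨{k, p, p}, by simp⟩, ⟨{k, p, q}, by simp⟩, ⟨{k, q, q}, by simp⟩, ⟨{k, p, r}, by simp⟩, ⟨{k, q, r}, by simp⟩, ⟨{k, r, r}, by simp⟩} :
            Finset (Sym (Fin 4) 3))).image
          (fun s : Sym (Fin 4) 3 => ((s : Multiset (Fin 4)).map d).sum)).image (fun m : ℕ => (m : ℝ)), ((n : ℝ) - E))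
    (c₀ c₁ c₂ c₃ c₄ c₅ : ℝ)
    (hc₀ : c₀ = W (2 * d p + d k) * (Matrix.det (∑ l, ((X : ℝ[X]) ^ d l) • (S l).map C)).coeff (2 * d p + d k))
    (hc₁ : c₁ = W (d p + d q + d k) * (Matrix.det (∑ l, ((X : ℝ[X]) ^ d l) • (S l).map C)).coeff (d p + d q + d k))
    (hc₂ : c₂ = W (2 * d q + d k) * (Matrix.det (∑ l, ((X : ℝ[X]) ^ d l) • (S l).map C)).coeff (2 * d q + d k))
    (hc₃ : c₃ = W (d p + d r + d k) * (Matrix.det (∑ l, ((X : ℝ[X]) ^ d l) • (S l).map C)).coeff (d p + d r + d k))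
    (hc₄ : c₄ = W (d q + d r + d k) * (Matrix.det (∑ l, ((X : ℝ[X]) ^ d l) • (S l).map C)).coeff (d q + d r + d k))
    (hc₅ : c₅ = W (2 * d r + d k) * (Matrix.det (∑ l, ((X : ℝ[X]) ^ d l) • (S l).map C)).coeff (2 * d r + d k)) :
    5 ≤ (((C c₀ * X ^ 0 + C c₁ * X ^ a + C c₂ * X ^ (2 * a) + C c₃ * X ^ b + C c₄ * X ^ (a + b) + C c₅ * X ^ (2 * b) : ℝ[X])).roots.toFinset.filter
      (fun t => 0 < t)).card := by
  set B : Finset (Sym (Fin 4) 3) :=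
    {⟨{k, p, p}, by simp⟩, ⟨{k, p, q}, by simp⟩, ⟨{k, q, q}, by simp⟩, ⟨{k, p, r}, by simp⟩, ⟨{k, q, r}, by simp⟩, ⟨{k, r, r}, by simp⟩} with hB
  obtain ⟨g, hg, hsupp, hZ⟩ := twistedSubword_sharp_of_nineteen d S h19 B ⟨_, Finset.mem_insert_self _ _⟩
  -- the window's exponents
  have hmemB : ∀ n ∈ g.support, n = 2 * d p + d k ∨ n = d p + d q + d k ∨ n = 2 * d q + d k ∨ n = d p + d r + d k
      ∨ n = d q + d r + d k ∨ n = 2 * d r + d k := by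
    intro n hn
    have h := hsupp hn
    rw [hB] at h
    simp only [Finset.image_insert, Finset.image_singleton, Finset.mem_insert, Finset.mem_singleton, Sym.coe_mk,
      Multiset.insert_eq_cons, Multiset.map_cons, Multiset.sum_cons, Multiset.map_singleton, Multiset.sum_singleton] at h
    omega
  -- `B` has six elements (its six exponents are distinct)
  have h6 : 6 ≤ B.card := by
    have hsub : ({2 * d p + d k, d p + d q + d k, 2 * d q + d k, d p + d r + d k, d q + d r + d k, 2 * d r + d k} : Finset ℕ)
        ⊆ B.image (fun s : Sym (Fin 4) 3 => ((s : Multiset (Fin 4)).map d).sum) := by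
      intro n hn
      rw [hB]
      simp only [Finset.image_insert, Finset.image_singleton, Finset.mem_insert, Finset.mem_singleton, Sym.coe_mk,
        Multiset.insert_eq_cons, Multiset.map_cons, Multiset.sum_cons, Multiset.map_singleton, Multiset.sum_singleton]
      simp only [Finset.mem_insert, Finset.mem_singleton] at hn
      omega
    have hc : ({2 * d p + d k, d p + d q + d k, 2 * d q + d k, d p + d r + d k, d q + d r + d k, 2 * d r + d k} : Finset ℕ).card = 6 := by
      rw [Finset.card_insert_of_notMem, Finset.card_insert_of_notMem, Finset.card_insert_of_notMem, Finset.card_insert_of_notMem,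
        Finset.card_insert_of_notMem, Finset.card_singleton] <;>
        simp only [Finset.mem_insert, Finset.mem_singleton] <;> omega
    calc 6 = _ := hc.symm
      _ ≤ (B.image (fun s : Sym (Fin 4) 3 => ((s : Multiset (Fin 4)).map d).sum)).card := Finset.card_le_card hsub
      _ ≤ B.card := Finset.card_image_le
  -- coefficients of `g`
  have hcoef : ∀ n, g.coeff n = W n * (Matrix.det (∑ l, ((X : ℝ[X]) ^ d l) • (S l).map C)).coeff n := by
    intro n; rw [hg, hW]
  have e1 : d p + d q + d k = 2 * d p + d k + a := by omega
  have e2 : 2 * d q + d k = 2 * d p + d k + 2 * a := by omega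
  have e3 : d p + d r + d k = 2 * d p + d k + b := by omega
  have e4 : d q + d r + d k = 2 * d p + d k + (a + b) := by omega
  have e5 : 2 * d r + d k = 2 * d p + d k + 2 * b := by omega
  -- `g` is the monomial `X^{2d_p + d_k}` times the six-nomial
  have hgeq : g = X ^ (2 * d p + d k) *
      (C c₀ * X ^ 0 + C c₁ * X ^ a + C c₂ * X ^ (2 * a) + C c₃ * X ^ b + C c₄ * X ^ (a + b) + C c₅ * X ^ (2 * b)) := by
    have hg6 : g = C c₀ * X ^ (2 * d p + d k) + C c₁ * X ^ (2 * d p + d k + a) + C c₂ * X ^ (2 * d p + d k + 2 * a)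
        + C c₃ * X ^ (2 * d p + d k + b) + C c₄ * X ^ (2 * d p + d k + (a + b)) + C c₅ * X ^ (2 * d p + d k + 2 * b) := by
      ext n
      simp only [coeff_add, coeff_C_mul, coeff_X_pow]
      by_cases h0 : n = 2 * d p + d k
      · subst h0
        rw [hcoef, ← hc₀, if_pos rfl, if_neg (by omega), if_neg (by omega), if_neg (by omega), if_neg (by omega), if_neg (by omega)]
        ring
      by_cases h1 : n = 2 * d p + d k + a
      · subst h1
        rw [hcoef, ← e1, ← hc₁, if_neg (by omega), e1, if_pos rfl, if_neg (by omega), if_neg (by omega), if_neg (by omega),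
          if_neg (by omega)]
        ring
      by_cases h2 : n = 2 * d p + d k + 2 * a
      · subst h2
        rw [hcoef, ← e2, ← hc₂, if_neg (by omega), if_neg (by omega), e2, if_pos rfl, if_neg (by omega), if_neg (by omega),
          if_neg (by omega)]
        ring
      by_cases h3 : n = 2 * d p + d k + b
      · subst h3
        rw [hcoef, ← e3, ← hc₃, if_neg (by omega), if_neg (by omega), if_neg (by omega), e3, if_pos rfl, if_neg (by omega),
          if_neg (by omega)]
        ring
      by_cases h4 : n = 2 * d p + d k + (a + b)
      · subst h4
        rw [hcoef, ← e4, ← hc₄, if_neg (by omega), if_neg (by omega), if_neg (by omega), if_neg (by omega), e4, if_pos rfl,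
          if_neg (by omega)]
        ring
      by_cases h5 : n = 2 * d p + d k + 2 * b
      · subst h5
        rw [hcoef, ← e5, ← hc₅, if_neg (by omega), if_neg (by omega), if_neg (by omega), if_neg (by omega), if_neg (by omega),
          e5, if_pos rfl]
        ring
      have hn : n ∉ g.support := fun hn => by
        rcases hmemB n hn with h | h | h | h | h | h <;> omega
      rw [notMem_support_iff.mp hn, if_neg h0, if_neg h1, if_neg h2, if_neg h3, if_neg h4, if_neg h5]
      ring
    rw [hg6]
    simp only [pow_add, pow_zero, mul_one]
    ring
  have hq : (C c₀ * X ^ 0 + C c₁ * X ^ a + C c₂ * X ^ (2 * a) + C c₃ * X ^ b + C c₄ * X ^ (a + b) + C c₅ * X ^ (2 * b) : ℝ[X]) ≠ 0 := by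
    intro hq
    rw [hgeq, hq, mul_zero, roots_zero, Multiset.toFinset_zero, Finset.filter_empty, Finset.card_empty] at hZ
    omega
  rw [hgeq, posRoots_X_pow_mul (2 * d p + d k) _ hq] at hZ
  omega

/-! ## 2. Gram orientation of the twisted letter windows -/

/-- **TWISTED LETTER WINDOW OF A NINETEEN, WINDOW SHAPE (`2a < b`): Gram-oriented** — `0 < c̃₅Δ̃ ∧ c̃₀Δ̃ < 0 ∧ c̃₂Δ̃ < 0`. [folklore] -/
theorem twistedLetterWindow_gram_orientation_of_nineteen (d : Fin 4 → ℕ) (S : Fin 4 → Matrix (Fin 3) (Fin 3) ℝ)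
    (h19 : 19 ≤ ((Matrix.det (∑ l, ((X : ℝ[X]) ^ d l) • (S l).map C)).roots.toFinset.filter (fun t => 0 < t)).card)
    (k p q r : Fin 4)
    {a b : ℕ} (ha : d q = d p + a) (hb : d r = d p + b) (ha0 : 0 < a) (hw : 2 * a < b)
    (W : ℕ → ℝ) (hW : ∀ n, W n =
      ∏ E ∈ (((Finset.univ : Finset (Sym (Fin 4) 3)) \
          ({⟨{k, p, p}, by simp⟩, ⟨{k, p, q}, by simp⟩, ⟨{k, q, q}, by simp⟩, ⟨{k, p, r}, by simp⟩, ⟨{k, q, r}, by simp⟩, ⟨{k, r, r}, by simp⟩} :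
            Finset (Sym (Fin 4) 3))).image
          (fun s : Sym (Fin 4) 3 => ((s : Multiset (Fin 4)).map d).sum)).image (fun m : ℕ => (m : ℝ)), ((n : ℝ) - E))
    (c₀ c₁ c₂ c₃ c₄ c₅ : ℝ)
    (hc₀ : c₀ = W (2 * d p + d k) * (Matrix.det (∑ l, ((X : ℝ[X]) ^ d l) • (S l).map C)).coeff (2 * d p + d k))
    (hc₁ : c₁ = W (d p + d q + d k) * (Matrix.det (∑ l, ((X : ℝ[X]) ^ d l) • (S l).map C)).coeff (d p + d q + d k))
    (hc₂ : c₂ = W (2 * d q + d k) * (Matrix.det (∑ l, ((X : ℝ[X]) ^ d l) • (S l).map C)).coeff (2 * d q + d k))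
    (hc₃ : c₃ = W (d p + d r + d k) * (Matrix.det (∑ l, ((X : ℝ[X]) ^ d l) • (S l).map C)).coeff (d p + d r + d k))
    (hc₄ : c₄ = W (d q + d r + d k) * (Matrix.det (∑ l, ((X : ℝ[X]) ^ d l) • (S l).map C)).coeff (d q + d r + d k))
    (hc₅ : c₅ = W (2 * d r + d k) * (Matrix.det (∑ l, ((X : ℝ[X]) ^ d l) • (S l).map C)).coeff (2 * d r + d k)) :
    0 < c₅ * (c₀ * c₂ * c₅ + c₁ * c₃ * c₄ / 4 - c₀ * c₄ ^ 2 / 4 - c₂ * c₃ ^ 2 / 4 - c₅ * c₁ ^ 2 / 4)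
      ∧ c₀ * (c₀ * c₂ * c₅ + c₁ * c₃ * c₄ / 4 - c₀ * c₄ ^ 2 / 4 - c₂ * c₃ ^ 2 / 4 - c₅ * c₁ ^ 2 / 4) < 0
      ∧ c₂ * (c₀ * c₂ * c₅ + c₁ * c₃ * c₄ / 4 - c₀ * c₄ ^ 2 / 4 - c₂ * c₃ ^ 2 / 4 - c₅ * c₁ ^ 2 / 4) < 0 :=
  orientation_eq_sign_gramDet a b ha0 hw c₀ c₁ c₂ c₃ c₄ c₅
    (twistedLetterWindow_five_roots_of_nineteen d S h19 k p q r ha hb ha0 (by omega) (by omega) W hW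
      c₀ c₁ c₂ c₃ c₄ c₅ hc₀ hc₁ hc₂ hc₃ hc₄ hc₅)

/-- **TWISTED LETTER WINDOW OF A NINETEEN, MIRROR SHAPE (`a < b < 2a`): Gram-oriented the other way** — `0 < c̃₀Δ̃ ∧ c̃₅Δ̃ < 0 ∧ c̃₂Δ̃ < 0`. [folklore] -/
theorem twistedLetterWindow_gram_orientation_of_nineteen_mirror (d : Fin 4 → ℕ) (S : Fin 4 → Matrix (Fin 3) (Fin 3) ℝ)
    (h19 : 19 ≤ ((Matrix.det (∑ l, ((X : ℝ[X]) ^ d l) • (S l).map C)).roots.toFinset.filter (fun t => 0 < t)).card)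
    (k p q r : Fin 4)
    {a b : ℕ} (ha : d q = d p + a) (hb : d r = d p + b) (hab : a < b) (hnw : b < 2 * a)
    (W : ℕ → ℝ) (hW : ∀ n, W n =
      ∏ E ∈ (((Finset.univ : Finset (Sym (Fin 4) 3)) \
          ({⟨{k, p, p}, by simp⟩, ⟨{k, p, q}, by simp⟩, ⟨{k, q, q}, by simp⟩, ⟨{k, p, r}, by simp⟩, ⟨{k, q, r}, by simp⟩, ⟨{k, r, r}, by simp⟩} :
            Finset (Sym (Fin 4) 3))).image
          (fun s : Sym (Fin 4) 3 => ((s : Multiset (Fin 4)).map d).sum)).image (fun m : ℕ => (m : ℝ)), ((n : ℝ) - E))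
    (c₀ c₁ c₂ c₃ c₄ c₅ : ℝ)
    (hc₀ : c₀ = W (2 * d p + d k) * (Matrix.det (∑ l, ((X : ℝ[X]) ^ d l) • (S l).map C)).coeff (2 * d p + d k))
    (hc₁ : c₁ = W (d p + d q + d k) * (Matrix.det (∑ l, ((X : ℝ[X]) ^ d l) • (S l).map C)).coeff (d p + d q + d k))
    (hc₂ : c₂ = W (2 * d q + d k) * (Matrix.det (∑ l, ((X : ℝ[X]) ^ d l) • (S l).map C)).coeff (2 * d q + d k))
    (hc₃ : c₃ = W (d p + d r + d k) * (Matrix.det (∑ l, ((X : ℝ[X]) ^ d l) • (S l).map C)).coeff (d p + d r + d k))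
    (hc₄ : c₄ = W (d q + d r + d k) * (Matrix.det (∑ l, ((X : ℝ[X]) ^ d l) • (S l).map C)).coeff (d q + d r + d k))
    (hc₅ : c₅ = W (2 * d r + d k) * (Matrix.det (∑ l, ((X : ℝ[X]) ^ d l) • (S l).map C)).coeff (2 * d r + d k)) :
    0 < c₀ * (c₀ * c₂ * c₅ + c₁ * c₃ * c₄ / 4 - c₀ * c₄ ^ 2 / 4 - c₂ * c₃ ^ 2 / 4 - c₅ * c₁ ^ 2 / 4)
      ∧ c₅ * (c₀ * c₂ * c₅ + c₁ * c₃ * c₄ / 4 - c₀ * c₄ ^ 2 / 4 - c₂ * c₃ ^ 2 / 4 - c₅ * c₁ ^ 2 / 4) < 0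
      ∧ c₂ * (c₀ * c₂ * c₅ + c₁ * c₃ * c₄ / 4 - c₀ * c₄ ^ 2 / 4 - c₂ * c₃ ^ 2 / 4 - c₅ * c₁ ^ 2 / 4) < 0 := by
  have ha0 : 0 < a := by omega
  exact orientation_eq_sign_gramDet_mirror a b hab hnw c₀ c₁ c₂ c₃ c₄ c₅
    (twistedLetterWindow_five_roots_of_nineteen d S h19 k p q r ha hb ha0 hab (by omega) W hW
      c₀ c₁ c₂ c₃ c₄ c₅ hc₀ hc₁ hc₂ hc₃ hc₄ hc₅)

/-! ## 3. The window coefficients of a nineteen in letters -/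

/-- **Letter window coefficients of a nineteen** (any real letters, any `d`; the `20` slot sums are distinct by `Census.sym_sum_injective_of_nineteen`):
the six coefficients of the `k`-window are `tr(adj S_p·S_k)`, `tr(B(S_p,S_q)·S_k)`, `tr(adj S_q·S_k)`, `tr(B(S_p,S_r)·S_k)`, `tr(B(S_q,S_r)·S_k)`, `tr(adj S_r·S_k)`,
`B(X,Y) = adj(X+Y) − adj X − adj Y`. [folklore] -/
theorem letterWindow_coeffs_eq_traces_of_nineteen (d : Fin 4 → ℕ) (S : Fin 4 → Matrix (Fin 3) (Fin 3) ℝ)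
    (h19 : 19 ≤ ((Matrix.det (∑ l, ((X : ℝ[X]) ^ d l) • (S l).map C)).roots.toFinset.filter (fun t => 0 < t)).card)
    (k p q r : Fin 4) (hkp : k ≠ p) (hkq : k ≠ q) (hkr : k ≠ r) (hpq : p ≠ q) (hpr : p ≠ r) (hqr : q ≠ r) :
    (Matrix.det (∑ l, ((X : ℝ[X]) ^ d l) • (S l).map C)).coeff (2 * d p + d k) = ((S p).adjugate * S k).trace
      ∧ (Matrix.det (∑ l, ((X : ℝ[X]) ^ d l) • (S l).map C)).coeff (d p + d q + d k)
          = (((S p + S q).adjugate - (S p).adjugate - (S q).adjugate) * S k).trace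
      ∧ (Matrix.det (∑ l, ((X : ℝ[X]) ^ d l) • (S l).map C)).coeff (2 * d q + d k) = ((S q).adjugate * S k).trace
      ∧ (Matrix.det (∑ l, ((X : ℝ[X]) ^ d l) • (S l).map C)).coeff (d p + d r + d k)
          = (((S p + S r).adjugate - (S p).adjugate - (S r).adjugate) * S k).trace
      ∧ (Matrix.det (∑ l, ((X : ℝ[X]) ^ d l) • (S l).map C)).coeff (d q + d r + d k)
          = (((S q + S r).adjugate - (S q).adjugate - (S r).adjugate) * S k).trace
      ∧ (Matrix.det (∑ l, ((X : ℝ[X]) ^ d l) • (S l).map C)).coeff (2 * d r + d k) = ((S r).adjugate * S k).trace :=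
  ⟨coeff_det_pencil_three_square d S (Ne.symm hkp) (square_unique_of_nineteen d S h19 (Ne.symm hkp)),
    coeff_det_pencil_three_mixed d S hpq (Ne.symm hkp) (Ne.symm hkq) (mixed_unique_of_nineteen d S h19 hpq (Ne.symm hkp) (Ne.symm hkq)),
    coeff_det_pencil_three_square d S (Ne.symm hkq) (square_unique_of_nineteen d S h19 (Ne.symm hkq)),
    coeff_det_pencil_three_mixed d S hpr (Ne.symm hkp) (Ne.symm hkr) (mixed_unique_of_nineteen d S h19 hpr (Ne.symm hkp) (Ne.symm hkr)),
    coeff_det_pencil_three_mixed d S hqr (Ne.symm hkq) (Ne.symm hkr) (mixed_unique_of_nineteen d S h19 hqr (Ne.symm hkq) (Ne.symm hkr)),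
    coeff_det_pencil_three_square d S (Ne.symm hkr) (square_unique_of_nineteen d S h19 (Ne.symm hkr))⟩

/-! ## 4. The certificates: the anti-oriented regions of the four letter windows carry no nineteen -/

/-- **CERTIFICATE FOR THE CRUX FORMAT (window shape `2a < b`).**  Any real `3 × 3` letters, any `d`, letters `k, p, q, r` pairwise distinct with
`d_q = d_p + a`, `d_r = d_p + b`, `0 < a`, `2a < b`.  With `W(n) = ∏ (n − σ(u))` over the exponents of the fourteen slots outside the `k`-window and the LETTER data
`c̃ = W·(tr(adj S_p·S_k), tr(B(S_p,S_q)·S_k), tr(adj S_q·S_k), tr(B(S_p,S_r)·S_k), tr(B(S_q,S_r)·S_k), tr(adj S_r·S_k))`: if the twisted `k`-window is NOT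
Gram-oriented, `c̃₅·Δ̃ ≤ 0`, the pencil has at most `18` distinct positive roots. [folklore] -/
theorem posRoots_le_18_of_twistedLetterWindow_antiOriented (d : Fin 4 → ℕ) (S : Fin 4 → Matrix (Fin 3) (Fin 3) ℝ)
    (k p q r : Fin 4) (hkp : k ≠ p) (hkq : k ≠ q) (hkr : k ≠ r) (hpq : p ≠ q) (hpr : p ≠ r) (hqr : q ≠ r)
    {a b : ℕ} (ha : d q = d p + a) (hb : d r = d p + b) (ha0 : 0 < a) (hw : 2 * a < b)
    (W : ℕ → ℝ) (hW : ∀ n, W n =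
      ∏ E ∈ (((Finset.univ : Finset (Sym (Fin 4) 3)) \
          ({⟨{k, p, p}, by simp⟩, ⟨{k, p, q}, by simp⟩, ⟨{k, q, q}, by simp⟩, ⟨{k, p, r}, by simp⟩, ⟨{k, q, r}, by simp⟩, ⟨{k, r, r}, by simp⟩} :
            Finset (Sym (Fin 4) 3))).image
          (fun s : Sym (Fin 4) 3 => ((s : Multiset (Fin 4)).map d).sum)).image (fun m : ℕ => (m : ℝ)), ((n : ℝ) - E))
    (c₀ c₁ c₂ c₃ c₄ c₅ : ℝ)
    (hc₀ : c₀ = W (2 * d p + d k) * ((S p).adjugate * S k).trace)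
    (hc₁ : c₁ = W (d p + d q + d k) * (((S p + S q).adjugate - (S p).adjugate - (S q).adjugate) * S k).trace)
    (hc₂ : c₂ = W (2 * d q + d k) * ((S q).adjugate * S k).trace)
    (hc₃ : c₃ = W (d p + d r + d k) * (((S p + S r).adjugate - (S p).adjugate - (S r).adjugate) * S k).trace)
    (hc₄ : c₄ = W (d q + d r + d k) * (((S q + S r).adjugate - (S q).adjugate - (S r).adjugate) * S k).trace)
    (hc₅ : c₅ = W (2 * d r + d k) * ((S r).adjugate * S k).trace)
    (hanti : c₅ * (c₀ * c₂ * c₅ + c₁ * c₃ * c₄ / 4 - c₀ * c₄ ^ 2 / 4 - c₂ * c₃ ^ 2 / 4 - c₅ * c₁ ^ 2 / 4) ≤ 0) :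
    ((Matrix.det (∑ l, ((X : ℝ[X]) ^ d l) • (S l).map C)).roots.toFinset.filter (fun t => 0 < t)).card ≤ 18 := by
  by_contra hlt
  have h19 : 19 ≤ ((Matrix.det (∑ l, ((X : ℝ[X]) ^ d l) • (S l).map C)).roots.toFinset.filter (fun t => 0 < t)).card := by omega
  obtain ⟨e0, e1, e2, e3, e4, e5⟩ := letterWindow_coeffs_eq_traces_of_nineteen d S h19 k p q r hkp hkq hkr hpq hpr hqr
  have h := (twistedLetterWindow_gram_orientation_of_nineteen d S h19 k p q r ha hb ha0 hw W hW c₀ c₁ c₂ c₃ c₄ c₅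
    (by rw [e0]; exact hc₀) (by rw [e1]; exact hc₁) (by rw [e2]; exact hc₂) (by rw [e3]; exact hc₃) (by rw [e4]; exact hc₄)
    (by rw [e5]; exact hc₅)).1
  linarith

/-- **CERTIFICATE FOR THE CRUX FORMAT (mirror shape `a < b < 2a`).**  Same letter data; if `c̃₀·Δ̃ ≤ 0` then at most `18` distinct positive roots. [folklore] -/
theorem posRoots_le_18_of_twistedLetterWindow_antiOriented_mirror (d : Fin 4 → ℕ) (S : Fin 4 → Matrix (Fin 3) (Fin 3) ℝ)
    (k p q r : Fin 4) (hkp : k ≠ p) (hkq : k ≠ q) (hkr : k ≠ r) (hpq : p ≠ q) (hpr : p ≠ r) (hqr : q ≠ r)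
    {a b : ℕ} (ha : d q = d p + a) (hb : d r = d p + b) (hab : a < b) (hnw : b < 2 * a)
    (W : ℕ → ℝ) (hW : ∀ n, W n =
      ∏ E ∈ (((Finset.univ : Finset (Sym (Fin 4) 3)) \
          ({⟨{k, p, p}, by simp⟩, ⟨{k, p, q}, by simp⟩, ⟨{k, q, q}, by simp⟩, ⟨{k, p, r}, by simp⟩, ⟨{k, q, r}, by simp⟩, ⟨{k, r, r}, by simp⟩} :
            Finset (Sym (Fin 4) 3))).image
          (fun s : Sym (Fin 4) 3 => ((s : Multiset (Fin 4)).map d).sum)).image (fun m : ℕ => (m : ℝ)), ((n : ℝ) - E))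
    (c₀ c₁ c₂ c₃ c₄ c₅ : ℝ)
    (hc₀ : c₀ = W (2 * d p + d k) * ((S p).adjugate * S k).trace)
    (hc₁ : c₁ = W (d p + d q + d k) * (((S p + S q).adjugate - (S p).adjugate - (S q).adjugate) * S k).trace)
    (hc₂ : c₂ = W (2 * d q + d k) * ((S q).adjugate * S k).trace)
    (hc₃ : c₃ = W (d p + d r + d k) * (((S p + S r).adjugate - (S p).adjugate - (S r).adjugate) * S k).trace)
    (hc₄ : c₄ = W (d q + d r + d k) * (((S q + S r).adjugate - (S q).adjugate - (S r).adjugate) * S k).trace)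
    (hc₅ : c₅ = W (2 * d r + d k) * ((S r).adjugate * S k).trace)
    (hanti : c₀ * (c₀ * c₂ * c₅ + c₁ * c₃ * c₄ / 4 - c₀ * c₄ ^ 2 / 4 - c₂ * c₃ ^ 2 / 4 - c₅ * c₁ ^ 2 / 4) ≤ 0) :
    ((Matrix.det (∑ l, ((X : ℝ[X]) ^ d l) • (S l).map C)).roots.toFinset.filter (fun t => 0 < t)).card ≤ 18 := by
  by_contra hlt
  have h19 : 19 ≤ ((Matrix.det (∑ l, ((X : ℝ[X]) ^ d l) • (S l).map C)).roots.toFinset.filter (fun t => 0 < t)).card := by omega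
  obtain ⟨e0, e1, e2, e3, e4, e5⟩ := letterWindow_coeffs_eq_traces_of_nineteen d S h19 k p q r hkp hkq hkr hpq hpr hqr
  have h := (twistedLetterWindow_gram_orientation_of_nineteen_mirror d S h19 k p q r ha hb hab hnw W hW c₀ c₁ c₂ c₃ c₄ c₅
    (by rw [e0]; exact hc₀) (by rw [e1]; exact hc₁) (by rw [e2]; exact hc₂) (by rw [e3]; exact hc₃) (by rw [e4]; exact hc₄)
    (by rw [e5]; exact hc₅)).1
  linarith

end Summit.ValiantsHypothesis.ValiantsHypothesis.Theorems.LacunarySymmetroidMatrixDescartes.Census
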